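import Literature.Analysis.OperatorTheory.Enflo2023.ExitStage
import Literature.Analysis.OperatorTheory.Enflo2023.Eq40
import HarnessLib

/-!
# Enflo (2023), Part A end to end: what the typed first half (pp.1–15) hands to the Main Construction

Source under adjudication: Per H. Enflo, *On the invariant subspace problem in Hilbert spaces*, arXiv:2305.15442
(v2, 2024), bib key `Enflo2023`.  [cite: Enflo2023, v2 p.13 (eq. (26), tex L443–L450: "if Case II happens every
time we obtain convergence to a non-cyclic vector … So assume that we at some stage get Case I"), p.15 eq. (33),
p.18 eq. (40)]

This module is os-F3b / BLOCK-2b repair-cell work (`pub-enflo`, formaliser 1): ONE kernel statement of what the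
cell's typing of Part A delivers from the manuscript's standing data at the first admissible vector `y₁'`.  NOTHING
here asserts the manuscript's main theorem: the disjunct `HasNontrivialClosedInvariantSubspace T` is reached only on
the text's own stopping branch ("Case II every time", `CaseII.caseI_exit_or_hasNontrivialClosedInvariantSubspace`)
or at a stage with `εθ = 0`; otherwise the conclusion is a START STATE for the Main Construction of Part B, whose
residual claim (`MCStep.Claim`, formaliser 2) is NOT touched here.

* `CaseII.exists_isMinimal_at_radius` — problem (1) for `V_y` at radius `‖x₀ − y‖` has a minimal solution (`e₀` is
  feasible);
* `CaseII.partA_handoff` — standing data at `y₀ = y₁'`: `‖T‖ ≤ 10⁻²⁰` (`‖T‖ < 1`), `‖x₀‖ = 1`,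
  `0.3 ≤ ‖x₀ − y₀‖ ≤ 0.7`, `(εθ)₀ = ⟨x₀ − y₀, y₀⟩ ∈ [0, 10⁻⁴]` real, (9) at `y₀`, and the type-1 cone (19)
  (`‖u₀‖ ≤ 1`, `Re⟨u₀, y₀⟩ ≥ ‖y₀‖/100`).  CONCLUSION: `T` has a non-trivial closed invariant subspace, OR there are
  `y` (an iterate `y_N` of THE run of (26), at its first Case-I stage) and `c` (THE minimal solution of (1) for `V_y`
  at radius `‖x₀ − y‖`) with: `εθ := ⟨x₀ − y, y⟩ ∈ (0, 1.12(εθ)₀]` real, `0.3 − 2.2(εθ)₀ ≤ ‖x₀ − y‖ ≤ 0.7`,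
  `‖y − y₀‖ ≤ 2.2(εθ)₀`, `y ∈ Lemma2.Adm u₀`, (9) at `y`, a Case I index at `y`, and the start control (33) in kernel
  form — `1 − γ(εθ) ≤ |c₀|² ≤ 1 − 0.96·10⁴⁰(εθ)^{22}`, `0.96·10⁴⁰(εθ)^{22} ≤ Σ_{j≥1}|c_j|² ≤ γ(εθ)`,
  `(1 − γ(εθ))‖c‖² ≤ |c₀|²` (`γ = Lemma2.gammaEps`, which tends to `0` with `εθ` or else a non-cyclic vector
  exists, `Lemma2.gammaEps_tendsto_zero_or`);
* `CaseII.eq40_head_at_exit` — the literal composition with formaliser 2's (40) engine: at that start state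
  `‖V_y c − c₀ y‖ ≤ ‖T‖(1 − ‖T‖²)^{-1/2} γ(εθ)^{1/2} ‖c‖ ‖y‖` (`Eq40.norm_V_sub_head_le_of_eq33` fed by
  `CaseII.eq33_at_exit`).

Part A's one inference that does not follow as printed (v2 p.13 tex L421–L423, "(27) gives the factor";
`CaseII.eq27_false_for_minimal`) is used nowhere on the way.  Origin: planner-b2b-enflo-1-g8-0 (F1 gen-8), 2026-08-19.
-/

noncomputable section

open scoped InnerProductSpace ENNReal
open Literature.Analysis.UnboundedOperators (inner_self_eq_coe_norm_sq)

namespace Literature.Analysis.OperatorTheory.Enflo2023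

variable {H : Type*} [NormedAddCommGroup H] [InnerProductSpace ℂ H] [CompleteSpace H]

namespace CaseII

open Vy Lemma2

/-- Problem (1) for `V_y` at radius `‖x₀ − y‖` has a minimal solution: the coefficient vector `e₀ = (1, 0, 0, …)`
is feasible (`V_y e₀ = y`). [cite: Enflo2023, v2 p.2, problem (1); p.8 (Lemma 1 set-up, `e₀` feasible)] -/
theorem exists_isMinimal_at_radius (T : H →L[ℂ] H) (hT : ‖T‖ < 1) (x₀ y : H) :
    ∃ c : ℓ2, IsMinimal (V T hT y) x₀ ‖x₀ - y‖ c := by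
  have h : V T hT y (lp.single 2 0 (1 : ℂ)) = y := by rw [V_single, pow_zero, one_apply_eq_self]
  exact exists_isMinimal _ _ _ ⟨lp.single 2 0 (1 : ℂ), by simp only [mem_feasible, h, le_refl]⟩

/-- **Part A end to end (kernel hand-off to the Main Construction).**  From the manuscript's standing data at
`y₀ = y₁'` — `‖T‖ ≤ 10⁻²⁰`, `‖x₀‖ = 1`, `0.3 ≤ ‖x₀ − y₀‖ ≤ 0.7`, `(εθ)₀ ∈ [0, 10⁻⁴]` real, (9) at `y₀`, the
type-1 cone (19) `Re⟨u₀, y₀⟩ ≥ ‖y₀‖/100` with `‖u₀‖ ≤ 1` —: EITHER `T` has a non-trivial closed invariant subspace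
(the text's "Case II every time" branch, or a stage with `εθ = 0`), OR THE run of (26) reaches a first Case-I stage
whose vector `y` and minimal solution `c` of (1) at radius `‖x₀ − y‖` satisfy: `εθ = ⟨x₀ − y, y⟩ ∈ (0, 1.12(εθ)₀]`
real, `0.3 − 2.2(εθ)₀ ≤ ‖x₀ − y‖ ≤ 0.7`, `‖y − y₀‖ ≤ 2.2(εθ)₀`, `y ∈ Adm u₀`, (9) at `y`, a Case I index
(`|⟨x₀ − y, T^j y⟩| > (εθ)⁴`, some `j ≥ 1`), and (33): `1 − γ(εθ) ≤ |c₀|² ≤ 1 − (0.98·10²⁰(εθ)^{11})²`,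
`(0.98·10²⁰(εθ)^{11})² ≤ Σ_{j≥1}|c_j|² ≤ γ(εθ)`, `(1 − γ(εθ))‖c‖² ≤ |c₀|²`.
[cite: Enflo2023, v2 p.13 (26) and tex L443–L450; p.12 (25); pp.10–11 Lemma 2; p.7 (19); p.15 (33)] -/
theorem partA_handoff (T : H →L[ℂ] H) (hT : ‖T‖ < 1) (hT20 : ‖T‖ ≤ 1 / 10 ^ 20) (x₀ y₀ u₀ : H)
    (hx₀ : ‖x₀‖ = 1) (hwin : 0.3 ≤ ‖x₀ - y₀‖ ∧ ‖x₀ - y₀‖ ≤ 0.7) (him : (⟪x₀ - y₀, y₀⟫_ℂ).im = 0)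
    (ht0 : 0 ≤ (⟪x₀ - y₀, y₀⟫_ℂ).re) (ht1 : (⟪x₀ - y₀, y₀⟫_ℂ).re ≤ 1 / 10 ^ 4)
    (h9 : ∀ m : ℕ, ‖⟪x₀ - y₀, (T ^ m) y₀⟫_ℂ‖ ≤ (⟪x₀ - y₀, y₀⟫_ℂ).re)
    (hu₀ : ‖u₀‖ ≤ 1) (hA : ‖y₀‖ / 100 ≤ (⟪u₀, y₀⟫_ℂ).re) :
    HasNontrivialClosedInvariantSubspace T ∨
      ∃ (y : H) (c : ℓ2),
        0 < (⟪x₀ - y, y⟫_ℂ).re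
        ∧ (⟪x₀ - y, y⟫_ℂ).im = 0
        ∧ (⟪x₀ - y, y⟫_ℂ).re ≤ 1.12 * (⟪x₀ - y₀, y₀⟫_ℂ).re
        ∧ 0.3 - 2.2 * (⟪x₀ - y₀, y₀⟫_ℂ).re ≤ ‖x₀ - y‖
        ∧ ‖x₀ - y‖ ≤ 0.7
        ∧ ‖y - y₀‖ ≤ 2.2 * (⟪x₀ - y₀, y₀⟫_ℂ).re
        ∧ y ∈ Adm u₀
        ∧ (∀ m : ℕ, ‖⟪x₀ - y, (T ^ m) y⟫_ℂ‖ ≤ (⟪x₀ - y, y⟫_ℂ).re)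
        ∧ (∃ j, 1 ≤ j ∧ (⟪x₀ - y, y⟫_ℂ).re ^ 4 < ‖⟪x₀ - y, (T ^ j) y⟫_ℂ‖)
        ∧ IsMinimal (V T hT y) x₀ ‖x₀ - y‖ c
        ∧ 1 - gammaEps T hT u₀ (⟪x₀ - y, y⟫_ℂ).re ≤ ‖c 0‖ ^ 2
        ∧ ‖c 0‖ ^ 2 ≤ 1 - (98 / 100 * 10 ^ 20 * (⟪x₀ - y, y⟫_ℂ).re ^ 11) ^ 2
        ∧ (98 / 100 * 10 ^ 20 * (⟪x₀ - y, y⟫_ℂ).re ^ 11) ^ 2 ≤ ‖L c‖ ^ 2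
        ∧ ‖L c‖ ^ 2 ≤ gammaEps T hT u₀ (⟪x₀ - y, y⟫_ℂ).re
        ∧ (1 - gammaEps T hT u₀ (⟪x₀ - y, y⟫_ℂ).re) * ‖c‖ ^ 2 ≤ ‖c 0‖ ^ 2 := by
  obtain ⟨y, a, hy0, hy⟩ := exists_run T hT x₀ y₀
  rcases first_caseI_stage_or_hasNontrivialClosedInvariantSubspace T hT hT20 x₀ y₀ hx₀ hwin him ht0 ht1 y a
      hy0 hy with hinv | ⟨N, hI, hII, hpos⟩
  · exact Or.inl hinv
  · right
    obtain ⟨c, hc⟩ := exists_isMinimal_at_radius T hT x₀ (y N)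
    obtain ⟨himN, -, hupN, hdN, hlowN, hdisp, -, h9N⟩ :=
      exit_package T hT hT20 x₀ y₀ hx₀ hwin him ht0 ht1 h9 y a hy0 hy N hII hpos
    obtain ⟨htN, hAdm, -⟩ :=
      exit_controls T hT hT20 x₀ y₀ hx₀ hwin him ht0 ht1 h9 y a hy0 hy N hII hpos u₀ hu₀ hA hI hc
    have h33 := eq33_at_exit T hT hT20 x₀ y₀ hx₀ hwin him ht0 ht1 h9 y a hy0 hy N hII hpos u₀ hu₀ hA hI hc
    exact ⟨y N, c, htN, himN, hupN, hlowN, hdN, hdisp, hAdm, h9N, hI, hc, h33⟩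

/-- **The literal link to (40).**  In the setting of `CaseII.eq33_at_exit` (THE run of (26), first Case-I stage
`N`, `c` THE minimiser at radius `‖x₀ − y_N‖`), formaliser 2's honest head estimate behind (40)
(`Eq40.norm_V_sub_head_le_of_eq33`) applies verbatim: `‖V_{y_N} c − c₀ y_N‖ ≤ ‖T‖(1 − ‖T‖²)^{-1/2} γ^{1/2}‖c‖‖y_N‖`
with `γ = γ((εθ)_N)` of Lemma 2.  (The direction form `Eq40.eq40_of_eq33` additionally wants the phase
normalisation `c₀ = r > 0`, the paper's standing reduction of v2 p.6.) [cite: Enflo2023, v2 p.15 (33), p.18 (40)] -/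
theorem eq40_head_at_exit (T : H →L[ℂ] H) (hT : ‖T‖ < 1) (hT20 : ‖T‖ ≤ 1 / 10 ^ 20) (x₀ y₀ : H)
    (hx₀ : ‖x₀‖ = 1) (hwin : 0.3 ≤ ‖x₀ - y₀‖ ∧ ‖x₀ - y₀‖ ≤ 0.7) (him : (⟪x₀ - y₀, y₀⟫_ℂ).im = 0)
    (ht0 : 0 ≤ (⟪x₀ - y₀, y₀⟫_ℂ).re) (ht1 : (⟪x₀ - y₀, y₀⟫_ℂ).re ≤ 1 / 10 ^ 4)
    (h9 : ∀ m : ℕ, ‖⟪x₀ - y₀, (T ^ m) y₀⟫_ℂ‖ ≤ (⟪x₀ - y₀, y₀⟫_ℂ).re)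
    (y : ℕ → H) (a : ℕ → ℓ2) (hy0 : y 0 = y₀)
    (hy : ∀ n, IsMinimal (V T hT (y n)) x₀ ‖x₀ - ((1 + (⟪x₀ - y n, y n⟫_ℂ).re / 10 : ℝ) : ℂ) • y n‖ (a n) ∧
      y (n + 1) = V T hT (y n) (a n))
    (N : ℕ) (hII : ∀ n, n < N → ∀ j, 1 ≤ j → ‖⟪x₀ - y n, (T ^ j) (y n)⟫_ℂ‖ ≤ (⟪x₀ - y n, y n⟫_ℂ).re ^ 4)
    (hpos : ∀ n, n < N → 0 < (⟪x₀ - y n, y n⟫_ℂ).re)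
    (u₀ : H) (hu₀ : ‖u₀‖ ≤ 1) (hA : ‖y₀‖ / 100 ≤ (⟪u₀, y₀⟫_ℂ).re)
    (hI : ∃ j, 1 ≤ j ∧ (⟪x₀ - y N, y N⟫_ℂ).re ^ 4 < ‖⟪x₀ - y N, (T ^ j) (y N)⟫_ℂ‖)
    {c : ℓ2} (hc : IsMinimal (V T hT (y N)) x₀ ‖x₀ - y N‖ c) :
    ‖V T hT (y N) c - c 0 • y N‖ ≤ ‖T‖ * Real.sqrt (1 / (1 - ‖T‖ ^ 2))
      * Real.sqrt (gammaEps T hT u₀ (⟪x₀ - y N, y N⟫_ℂ).re) * ‖c‖ * ‖y N‖ :=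
  Eq40.norm_V_sub_head_le_of_eq33 T hT (y N) (gammaEps_nonneg T hT u₀ _)
    (eq33_at_exit T hT hT20 x₀ y₀ hx₀ hwin him ht0 ht1 h9 y a hy0 hy N hII hpos u₀ hu₀ hA hI hc).2.2.2.2

end CaseII

end Literature.Analysis.OperatorTheory.Enflo2023

end
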